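import Mathlib
import Summits.NavierStokesRegularity.NavierStokesRegularity.Theorems.SubOnsagerCeilingKPEntropyBalance
import HarnessLib

/-!
# KP networks proper: the ENTROPY CAPTURE LAW — a shell's `p`-entropy is at most the entropy it received through
# the bond below (helper file for the crux `SubOnsagerCeiling.ForwardTailCeilingKP`, stmt-NavierStokesRegularity-27057,
# `--supports`; hand leafhand-ns-subonsagerceiling-4 gen 24; def-free; corollary of `SubOnsagerCeilingKPEntropyBalance`)

Single-shell weights `c = 1_{m = n}` in the production socket `kpProper_entropyPartialSum_le_datum_add_production` give, along
every honest non-negative `ν`-viscous solution of a KP network proper from a one-shell datum (`E_m = Σ_i ½X_{i,m}²`, bond fluxes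
`OUT_m = (1+ε₀)^{5m/2} Σ_{i,j} w_{ij} X_{i,m}² X_{j,m+1}`), for every shell `n ≥ 1`, power `p ≥ 1` and `t ∈ [0,s]`:

* **`kpProper_entropyCapture`** — `E_n(t)^p ≤ p ∫₀ᵗ OUT_{n-1}(τ) · E_n(τ)^{p-1} dτ`: the `p`-th power of a shell energy never
  exceeds the `p`-ENTROPY RECEIVED through the bond below (out-flux and dissipation of the shell only help).  `p = 1` is the
  flux budget of `SubOnsagerCeilingKPFluxBudget`; `p = 1/2`-flavoured amplitude versions are the occupation / capture laws of
  `Theorems.KPChainOccupation` and of the 25507 refutation lineage (`…SideBranchCapture*`).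
* **`kpProper_weightedBarrier_of_bondMoment`** — hence a ν-uniform bound on ONE weighted bond moment per shell,
  `p · β^n ∫₀ᵗ OUT_{n-1} E_n^{p-1} ≤ M` (any weight `β > 0`), is the weighted barrier `β^n E_n(t)^p ≤ M` at that shell; with the
  entropy weight `β = (1+ε₀)^{(5/3)(p-1)}`, `p > 5/2`, this is the registered `θ_p`-shell barrier (`θ_p = (5/6)(1−1/p) > 1/2`,
  exchange rate `Theorems/SubOnsagerCeilingKPEntropyCurrency.lean`).

Reading (memo ENTROPY-PRODUCTION-leafhand4-g24 on the item): in the inviscid limit with emptying shells the received entropies obey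
`R_{n+1} = R_n − (dissipated) + (net production at bond n)`, so the barrier for the whole class is EXACTLY a statement about the
cumulative NET bond production `Σ_{m<n} ∫ OUT_m (β^{m+1}E_{m+1}^{p-1} − β^m E_m^{p-1})` — measured ≤ 0 along the chain at every tested
ratio (the gross production is large and cancels bond by bond).  NOT proved here: any bound on a bond moment along actual trajectories.
HONEST FRAMING: statements about Tao-type MODEL lattice ODEs (route SubOnsagerCeiling, rung TL-M2Break); elementary energy
bookkeeping; nothing here bears on Navier–Stokes regularity and no stub, crux or summit is proved.
[cite: Tao2016AveragedNS, §4 (4.6)–(4.9), (4.13)]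
-/

noncomputable section

-- the sub-problem namespace `NavierStokesRegularity.NavierStokesRegularity` is the tree's layout (D-0017)
set_option linter.dupNamespace false

namespace Summit.NavierStokesRegularity.NavierStokesRegularity.Theorems

open Set Finset MeasureTheory intervalIntegral
open scoped Topology
open Literature.Analysis.FluidPDE.TaoCascade

variable {α : Fin 4 → Fin 4 → Fin 4 → ℤ × ℤ × ℤ → ℝ}

/-- **ENTROPY CAPTURE LAW.**  Along an honest non-negative `ν`-viscous solution (`ν ≥ 0`, `1+ε₀ > 0`, shells `≥ 1` non-negative)
of a KP network proper from a one-shell datum on shell `0`, for every shell `n ≥ 1`, power `p ≥ 1` and `t ∈ [0,s]`: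
`(Σ_i ½X_{i,n}(t)²)^p ≤ p ∫₀ᵗ OUT_{n-1}(τ) (Σ_i ½X_{i,n}(τ)²)^{p-1} dτ`. MODEL lattice statement.
[cite: Tao2016AveragedNS, §4 (4.8)–(4.9), (4.13)] -/
theorem kpProper_entropyCapture (hs : IsSymmetricCoeff α) (hc : IsCancellingCoeff α)
    (hO : ∀ (Y : Fin 4 → ℤ → ℝ → ℝ) (τ : ℝ), (∀ (j : Fin 4) (k : ℤ), 1 ≤ k → 0 ≤ Y j k τ) →
      ∀ δ : ℝ, 0 < δ → ∀ (i : Fin 4) (n : ℤ), 1 ≤ n → Y i n τ = 0 → 0 ≤ quadTerm δ α Y i n τ)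
    (hD : ∀ a b i : Fin 4, a ≠ b → α a b i (0, 0, 1) = 0)
    {ε₀ ν s : ℝ} (hε : 0 < 1 + ε₀) (hν : 0 ≤ ν) {X₀ : Fin 4 → ℝ} {X : Fin 4 → ℤ → ℝ → ℝ}
    (hdat : ∀ (i : Fin 4) (k : ℤ), X i k 0 = if k = 0 then X₀ i else 0)
    (hvan : ∀ (i : Fin 4) (k : ℤ), k < 0 → ∀ t : ℝ, X i k t = 0)
    (hXc : ∀ (i : Fin 4) (k : ℤ), Continuous (X i k))
    (hode : ∀ (i : Fin 4) (k : ℤ), ∀ t ∈ Icc (0 : ℝ) s, HasDerivWithinAt (X i k)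
      (quadTerm ε₀ α X i k t - ν * (1 + ε₀) ^ ((2 : ℝ) * k) * X i k t) (Icc (0 : ℝ) s) t)
    (hnn : ∀ t ∈ Icc (0 : ℝ) s, ∀ (i : Fin 4) (k : ℤ), 1 ≤ k → 0 ≤ X i k t)
    {p : ℕ} (hp : 1 ≤ p) {n : ℕ} (hn : 1 ≤ n) :
    ∀ t ∈ Icc (0 : ℝ) s,
      (∑ i, (1 / 2 : ℝ) * X i (n : ℤ) t ^ 2) ^ p ≤
        (p : ℝ) * ∫ τ in (0 : ℝ)..t,
          ((1 + ε₀) ^ ((5 : ℝ) * (((n - 1 : ℕ) : ℝ)) / 2) *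
              ∑ i, ∑ j, α i i j (0, 0, 1) * X i ((n - 1 : ℕ) : ℤ) τ ^ 2 * X j (((n - 1 : ℕ) : ℤ) + 1) τ) *
            (∑ i, (1 / 2 : ℝ) * X i (((n - 1 : ℕ) : ℤ) + 1) τ ^ 2) ^ (p - 1) := by
  intro t ht
  obtain ⟨m, rfl⟩ : ∃ m, n = m + 1 := ⟨n - 1, by omega⟩
  simp only [Nat.add_sub_cancel]
  -- single-shell weights
  set c : ℕ → ℝ := fun k => if k = m + 1 then 1 else 0 with hcdef
  have hcw : ∀ k, 0 ≤ c k := fun k => by simp only [hcdef]; split_ifs <;> norm_num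
  have hsock := kpProper_entropyPartialSum_le_datum_add_production hs hc hO hD hε hν hdat hvan hXc hode hnn hcw hp
    (m + 1) t ht
  -- left-hand side: only the shell `m+1` survives
  have hL : ∑ k ∈ Finset.range (m + 1 + 1), c k * (∑ i, (1 / 2 : ℝ) * X i (k : ℤ) t ^ 2) ^ p =
      (∑ i, (1 / 2 : ℝ) * X i (((m + 1 : ℕ)) : ℤ) t ^ 2) ^ p := by
    rw [Finset.sum_eq_single_of_mem (m + 1) (by simp)]
    · simp [hcdef]
    · intro k _ hk
      simp [hcdef, hk]
  -- datum term vanishes (`c 0 = 0`)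
  have hc0 : c 0 = 0 := by simp [hcdef]
  -- production: only the bond `m` contributes, with weight `c (m+1) = 1` on the receiving side
  have hP : ∀ τ : ℝ, ∑ k ∈ Finset.range (m + 1),
      ((1 + ε₀) ^ ((5 : ℝ) * (k : ℝ) / 2) *
          ∑ i, ∑ j, α i i j (0, 0, 1) * X i (k : ℤ) τ ^ 2 * X j ((k : ℤ) + 1) τ) *
        (c (k + 1) * (∑ i, (1 / 2 : ℝ) * X i ((k : ℤ) + 1) τ ^ 2) ^ (p - 1) -
          c k * (∑ i, (1 / 2 : ℝ) * X i (k : ℤ) τ ^ 2) ^ (p - 1)) =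
      ((1 + ε₀) ^ ((5 : ℝ) * (m : ℝ) / 2) *
          ∑ i, ∑ j, α i i j (0, 0, 1) * X i (m : ℤ) τ ^ 2 * X j ((m : ℤ) + 1) τ) *
        (∑ i, (1 / 2 : ℝ) * X i ((m : ℤ) + 1) τ ^ 2) ^ (p - 1) := by
    intro τ
    rw [Finset.sum_eq_single_of_mem m (by simp)]
    · have h1 : c (m + 1) = 1 := by simp [hcdef]
      have h2 : c m = 0 := by simp [hcdef]
      rw [h1, h2]; ring
    · intro k hk hkm
      have hk' : k < m + 1 := Finset.mem_range.1 hk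
      have h1 : c (k + 1) = 0 := by
        simp only [hcdef]; rw [if_neg]; omega
      have h2 : c k = 0 := by
        simp only [hcdef]; rw [if_neg]; omega
      rw [h1, h2]; ring
  rw [hL, hc0, zero_mul, zero_add] at hsock
  rw [intervalIntegral.integral_congr (fun τ _ => hP τ)] at hsock
  have hcast : (((m + 1 : ℕ)) : ℤ) = (m : ℤ) + 1 := by push_cast; ring
  rw [hcast] at hsock
  exact hsock

/-- **Weighted barrier from a bond moment.**  Under the hypotheses of `kpProper_entropyCapture`, for every weight `β > 0`,
shell `n ≥ 1` and time `t ∈ [0,s]`: if `p · β^n ∫₀ᵗ OUT_{n-1} E_n^{p-1} ≤ M` then `β^n E_n(t)^p ≤ M`.  With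
`β = (1+ε₀)^{(5/3)(p-1)}`, `p > 5/2`, this is the registered `θ_p`-shell barrier at shell `n`
(`Theorems/SubOnsagerCeilingKPEntropyCurrency.lean`). MODEL lattice statement. [cite: Tao2016AveragedNS, §4 (4.8)–(4.9), (4.13)] -/
theorem kpProper_weightedBarrier_of_bondMoment (hs : IsSymmetricCoeff α) (hc : IsCancellingCoeff α)
    (hO : ∀ (Y : Fin 4 → ℤ → ℝ → ℝ) (τ : ℝ), (∀ (j : Fin 4) (k : ℤ), 1 ≤ k → 0 ≤ Y j k τ) →
      ∀ δ : ℝ, 0 < δ → ∀ (i : Fin 4) (n : ℤ), 1 ≤ n → Y i n τ = 0 → 0 ≤ quadTerm δ α Y i n τ)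
    (hD : ∀ a b i : Fin 4, a ≠ b → α a b i (0, 0, 1) = 0)
    {ε₀ ν s : ℝ} (hε : 0 < 1 + ε₀) (hν : 0 ≤ ν) {X₀ : Fin 4 → ℝ} {X : Fin 4 → ℤ → ℝ → ℝ}
    (hdat : ∀ (i : Fin 4) (k : ℤ), X i k 0 = if k = 0 then X₀ i else 0)
    (hvan : ∀ (i : Fin 4) (k : ℤ), k < 0 → ∀ t : ℝ, X i k t = 0)
    (hXc : ∀ (i : Fin 4) (k : ℤ), Continuous (X i k))
    (hode : ∀ (i : Fin 4) (k : ℤ), ∀ t ∈ Icc (0 : ℝ) s, HasDerivWithinAt (X i k)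
      (quadTerm ε₀ α X i k t - ν * (1 + ε₀) ^ ((2 : ℝ) * k) * X i k t) (Icc (0 : ℝ) s) t)
    (hnn : ∀ t ∈ Icc (0 : ℝ) s, ∀ (i : Fin 4) (k : ℤ), 1 ≤ k → 0 ≤ X i k t)
    {p : ℕ} (hp : 1 ≤ p) {n : ℕ} (hn : 1 ≤ n) {β M : ℝ} (hβ : 0 < β) {t : ℝ} (ht : t ∈ Icc (0 : ℝ) s)
    (hmom : (p : ℝ) * (β ^ n * ∫ τ in (0 : ℝ)..t,
      ((1 + ε₀) ^ ((5 : ℝ) * (((n - 1 : ℕ) : ℝ)) / 2) *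
          ∑ i, ∑ j, α i i j (0, 0, 1) * X i ((n - 1 : ℕ) : ℤ) τ ^ 2 * X j (((n - 1 : ℕ) : ℤ) + 1) τ) *
        (∑ i, (1 / 2 : ℝ) * X i (((n - 1 : ℕ) : ℤ) + 1) τ ^ 2) ^ (p - 1)) ≤ M) :
    β ^ n * (∑ i, (1 / 2 : ℝ) * X i (n : ℤ) t ^ 2) ^ p ≤ M := by
  have hcap := kpProper_entropyCapture hs hc hO hD hε hν hdat hvan hXc hode hnn hp hn t ht
  have hβn : 0 ≤ β ^ n := pow_nonneg hβ.le n
  calc β ^ n * (∑ i, (1 / 2 : ℝ) * X i (n : ℤ) t ^ 2) ^ p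
      ≤ β ^ n * ((p : ℝ) * ∫ τ in (0 : ℝ)..t,
          ((1 + ε₀) ^ ((5 : ℝ) * (((n - 1 : ℕ) : ℝ)) / 2) *
              ∑ i, ∑ j, α i i j (0, 0, 1) * X i ((n - 1 : ℕ) : ℤ) τ ^ 2 * X j (((n - 1 : ℕ) : ℤ) + 1) τ) *
            (∑ i, (1 / 2 : ℝ) * X i (((n - 1 : ℕ) : ℤ) + 1) τ ^ 2) ^ (p - 1)) :=
        mul_le_mul_of_nonneg_left hcap hβn
    _ = _ := by ring
    _ ≤ M := hmom

end Summit.NavierStokesRegularity.NavierStokesRegularity.Theorems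

end
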